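import Summits.KontsevichZagierPeriods.KontsevichZagierPeriods.Theorems.SoloInformedCircleSubst
import Summits.KontsevichZagierPeriods.KontsevichZagierPeriods.Theorems.SoloInformedKZPOneKArea
import HarnessLib
import HarnessLib.Audit

/-!
# SoloInformed — the Kontsevich–Zagier example: the representations of `π` in [KZ01, §1.1]

Solo programme `solo-KontsevichZagierPeriods-informed`, session s112, file 28.

Kontsevich–Zagier open §1.1 of *Periods* with
`π = ∬_{x²+y²≤1} dx dy = 2 ∫_{−1}^{1} √(1 − x²) dx = ∫_{−1}^{1} dx/√(1 − x²)`, and Question 1 of §1.2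
asks whether any two integral representations of the same period are connected by the three rules.
This file DECIDES the question for this example, with no hypotheses left: the explicit absolutely
convergent representations
* `soloInformedPiRepSqrt = [(−1, 1), 2√(1 − x²)]` (dimension `1`),
* `soloInformedPiRepInvSqrt = [(−1, 1), 1/√(1 − x²)]` (dimension `1`, improper at both ends),
* any `G = [{(x, y) | −1 < x < 1, 0 ≤ y ≤ 2√(1 − x²)}, 1]` (dimension `2`, half of the ellipse
  `x² + y²/4 ≤ 1`; such a `G` exists, `soloInformed_exists_piRepArea`)
all have value `π` (`soloInformed_value_piRepSqrt`, `soloInformed_value_piRepInvSqrt`; Mathlib's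
`integral_sqrt_one_sub_sq` and the `arcsin` primitive) and are pairwise KZ-equivalent
(`soloInformed_kz_example_pi`, `soloInformed_kz_example_pi_area`): both one-dimensional
integrands are rational in `(x, √(1 − x²))` (file 25), and the area representation is one
Newton–Leibniz move away (file 21).  The unit disc itself differs from `G` by a linear change of
variables and a cut along the diameter; that bookkeeping is not repeated here.

References: M. Kontsevich, D. Zagier, *Periods* (2001), §1.1 and §1.2 Question 1.
-/

noncomputable section

open scoped BigOperators Polynomial

namespace Summit.KontsevichZagierPeriods.KontsevichZagierPeriods.Theorems

open Set MeasureTheory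
open Literature.ModelTheory.ExponentialFields
open Literature.NumberTheory.Transcendental Literature.NumberTheory.Transcendental.KZ

/-! ## The domain `(−1, 1)` and the two integrands -/

/-- The open interval `(−1, 1) ⊆ ℝ¹`. -/
def soloInformedPiDom : Set (Fin 1 → ℝ) := {w | w 0 ∈ Ioo (-1 : ℝ) 1}

/-- Membership in `(−1, 1)`. -/
theorem soloInformed_mem_piDom {w : Fin 1 → ℝ} : w ∈ soloInformedPiDom ↔ -1 < w 0 ∧ w 0 < 1 :=
  Iff.rfl

/-- `(−1, 1)` is `ℚ`-semialgebraic. -/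
theorem soloInformed_isSemialgebraic_piDom : IsSemialgebraic ℚ soloInformedPiDom := by
  have h1 : IsSemialgebraic ℚ {x : Fin 1 → ℝ |
      0 < MvPolynomial.aeval x (MvPolynomial.X 0 + 1 : MvPolynomial (Fin 1) ℚ)} :=
    isSemialgebraic_setOf_eval_pos _
  have h2 : IsSemialgebraic ℚ {x : Fin 1 → ℝ |
      0 < MvPolynomial.aeval x (1 - MvPolynomial.X 0 : MvPolynomial (Fin 1) ℚ)} :=
    isSemialgebraic_setOf_eval_pos _
  convert h1.inter h2 using 1
  ext w
  simp only [soloInformed_mem_piDom, mem_inter_iff, mem_setOf_eq, map_add, map_one, map_sub,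
    MvPolynomial.aeval_X]
  constructor
  · rintro ⟨ha, hb⟩; exact ⟨by linarith, by linarith⟩
  · rintro ⟨ha, hb⟩; exact ⟨by linarith, by linarith⟩

/-- On `(−1, 1)`: `0 < 1 − x²`. -/
theorem soloInformed_one_sub_sq_pos {w : Fin 1 → ℝ} (hw : w ∈ soloInformedPiDom) :
    0 < 1 - w 0 ^ 2 := by
  obtain ⟨h1, h2⟩ := soloInformed_mem_piDom.1 hw
  nlinarith

/-- `x ↦ √(1 − x²)` is `ℚ`-semialgebraic on `(−1, 1)`. -/
theorem soloInformed_isSemialgebraicFunOn_sqrt_one_sub_sq :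
    IsSemialgebraicFunOn ℚ soloInformedPiDom fun x => Real.sqrt (1 - x 0 ^ 2) := by
  have hq : IsSemialgebraicFunOn ℚ soloInformedPiDom fun x => 1 - x 0 ^ 2 :=
    (isSemialgebraicFunOn_aeval soloInformed_isSemialgebraic_piDom
      (1 - MvPolynomial.X 0 ^ 2 : MvPolynomial (Fin 1) ℚ)).congr fun x _ => by simp
  exact IsSemialgebraicFunOn.sqrt_holds hq

/-- `x ↦ 2√(1 − x²)` is `ℚ`-semialgebraic on `(−1, 1)`. -/
theorem soloInformed_isSemialgebraicFunOn_two_mul_sqrt :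
    IsSemialgebraicFunOn ℚ soloInformedPiDom fun x => 2 * Real.sqrt (1 - x 0 ^ 2) := by
  have h2 : IsSemialgebraicFunOn ℚ soloInformedPiDom fun _ => (2 : ℝ) :=
    (isSemialgebraicFunOn_aeval soloInformed_isSemialgebraic_piDom
      (MvPolynomial.C 2 : MvPolynomial (Fin 1) ℚ)).congr fun x _ => by simp
  exact (IsSemialgebraicFunOn.mul_holds h2 soloInformed_isSemialgebraicFunOn_sqrt_one_sub_sq).congr
    fun _ _ => rfl

/-- `x ↦ 1/√(1 − x²)` is `ℚ`-semialgebraic on `(−1, 1)` (it is `√(1 − x²) · (1 − x²)⁻¹` there). -/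
theorem soloInformed_isSemialgebraicFunOn_inv_sqrt :
    IsSemialgebraicFunOn ℚ soloInformedPiDom fun x => (Real.sqrt (1 - x 0 ^ 2))⁻¹ := by
  have hq : IsSemialgebraicFunOn ℚ soloInformedPiDom fun x =>
      (MvPolynomial.aeval x (1 : MvPolynomial (Fin 1) ℚ) : ℝ) /
        MvPolynomial.aeval x (1 - MvPolynomial.X 0 ^ 2 : MvPolynomial (Fin 1) ℚ) :=
    isSemialgebraicFunOn_aeval_div_aeval soloInformed_isSemialgebraic_piDom _ _ fun v hv => by
      rw [map_sub, map_one, map_pow, MvPolynomial.aeval_X]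
      exact (soloInformed_one_sub_sq_pos hv).ne'
  refine (IsSemialgebraicFunOn.mul_holds soloInformed_isSemialgebraicFunOn_sqrt_one_sub_sq hq).congr
    fun x hx => ?_
  have hpos := soloInformed_one_sub_sq_pos hx
  have hs : Real.sqrt (1 - x 0 ^ 2) * Real.sqrt (1 - x 0 ^ 2) = 1 - x 0 ^ 2 :=
    Real.mul_self_sqrt hpos.le
  have hsp : 0 < Real.sqrt (1 - x 0 ^ 2) := Real.sqrt_pos.2 hpos
  show Real.sqrt (1 - x 0 ^ 2) * ((MvPolynomial.aeval x (1 : MvPolynomial (Fin 1) ℚ) : ℝ) /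
      MvPolynomial.aeval x (1 - MvPolynomial.X 0 ^ 2 : MvPolynomial (Fin 1) ℚ)) =
    (Real.sqrt (1 - x 0 ^ 2))⁻¹
  rw [map_one, map_sub, map_one, map_pow, MvPolynomial.aeval_X, mul_one_div, div_eq_iff hpos.ne',
    inv_mul_eq_div, eq_div_iff hsp.ne']
  exact hs

/-! ## Integrability and values (Mathlib: `integral_sqrt_one_sub_sq`, `Real.arcsin`) -/

/-- `∫_{(−1,1)} 2√(1 − t²) dt = π`. -/
theorem soloInformed_integral_two_mul_sqrt :
    ∫ t in Ioo (-1 : ℝ) 1, 2 * Real.sqrt (1 - t ^ 2) = Real.pi := by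
  rw [← integral_Ioc_eq_integral_Ioo, ← intervalIntegral.integral_of_le (by norm_num),
    intervalIntegral.integral_const_mul, integral_sqrt_one_sub_sq]
  ring

/-- `t ↦ 1/√(1 − t²)` is integrable on `(−1, 1)` (its primitive `arcsin` is monotone and bounded). -/
theorem soloInformed_integrableOn_inv_sqrt :
    IntegrableOn (fun t : ℝ => (Real.sqrt (1 - t ^ 2))⁻¹) (Ioc (-1 : ℝ) 1) := by
  have hle : (-1 : ℝ) ≤ 1 := by norm_num
  have h := intervalIntegral.integrableOn_deriv_of_nonneg (g := Real.arcsin)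
    (g' := fun t : ℝ => (Real.sqrt (1 - t ^ 2))⁻¹) (a := (-1 : ℝ)) (b := 1) ?_ ?_ ?_
  · simpa only [min_eq_left hle, max_eq_right hle] using h
  · exact Real.continuous_arcsin.continuousOn
  · intro x hx
    have hx' : x ∈ Ioo (-1 : ℝ) 1 := by simpa only [min_eq_left hle, max_eq_right hle] using hx
    simpa only [one_div] using Real.hasDerivAt_arcsin hx'.1.ne' hx'.2.ne
  · intro x _
    positivity

/-- `∫_{(−1,1)} dt/√(1 − t²) = arcsin 1 − arcsin(−1) = π`. -/
theorem soloInformed_integral_inv_sqrt :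
    ∫ t in Ioo (-1 : ℝ) 1, (Real.sqrt (1 - t ^ 2))⁻¹ = Real.pi := by
  have hle : (-1 : ℝ) ≤ 1 := by norm_num
  rw [← integral_Ioc_eq_integral_Ioo, ← intervalIntegral.integral_of_le hle,
    intervalIntegral.integral_eq_sub_of_hasDerivAt_of_le hle Real.continuous_arcsin.continuousOn
      (fun x hx => by simpa only [one_div] using Real.hasDerivAt_arcsin hx.1.ne' hx.2.ne)
      ((intervalIntegrable_iff_integrableOn_Ioc_of_le hle).2 soloInformed_integrableOn_inv_sqrt),
    Real.arcsin_one, Real.arcsin_neg_one]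
  ring

/-! ## The representations -/

/-- `[(−1, 1), 2√(1 − x²)]`. -/
def soloInformedPiRepSqrt : IntegralRep 1 :=
  ⟨soloInformedPiDom, fun x => 2 * Real.sqrt (1 - x 0 ^ 2), soloInformed_isSemialgebraic_piDom,
    soloInformed_isSemialgebraicFunOn_two_mul_sqrt,
    -- transport along `ℝ¹ ≃ ℝ` (as in `KZ.integrableOn_setOf_apply_mem_iff`, KZBetaChains)
    ((volume_preserving_funUnique (Fin 1) ℝ).integrableOn_comp_preimage
      (MeasurableEquiv.funUnique (Fin 1) ℝ).measurableEmbedding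
      (f := fun t : ℝ => 2 * Real.sqrt (1 - t ^ 2)) (s := Ioo (-1 : ℝ) 1)).2
      (((continuous_const.mul (Real.continuous_sqrt.comp (by fun_prop))).integrableOn_Icc
        (a := (-1 : ℝ)) (b := 1)).mono_set Ioo_subset_Icc_self)⟩

/-- `[(−1, 1), 1/√(1 − x²)]`. -/
def soloInformedPiRepInvSqrt : IntegralRep 1 :=
  ⟨soloInformedPiDom, fun x => (Real.sqrt (1 - x 0 ^ 2))⁻¹, soloInformed_isSemialgebraic_piDom,
    soloInformed_isSemialgebraicFunOn_inv_sqrt,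
    ((volume_preserving_funUnique (Fin 1) ℝ).integrableOn_comp_preimage
      (MeasurableEquiv.funUnique (Fin 1) ℝ).measurableEmbedding
      (f := fun t : ℝ => (Real.sqrt (1 - t ^ 2))⁻¹) (s := Ioo (-1 : ℝ) 1)).2
      (soloInformed_integrableOn_inv_sqrt.mono_set Ioo_subset_Ioc_self)⟩

/-- `∫_{(−1,1)} 2√(1 − x²) dx = π`. [Kontsevich–Zagier 2001, §1.1] -/
theorem soloInformed_value_piRepSqrt : soloInformedPiRepSqrt.value = Real.pi := by
  show ∫ w in {w : Fin 1 → ℝ | w 0 ∈ Ioo (-1 : ℝ) 1}, 2 * Real.sqrt (1 - w 0 ^ 2) = Real.pi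
  -- transport along `ℝ¹ ≃ ℝ` (`MeasurableEquiv.funUnique`, volume preserving), inlined
  have hmp : MeasurePreserving (MeasurableEquiv.funUnique (Fin 1) ℝ) volume volume :=
    volume_preserving_funUnique (Fin 1) ℝ
  have hset : {w : Fin 1 → ℝ | w 0 ∈ Ioo (-1 : ℝ) 1} =
      (MeasurableEquiv.funUnique (Fin 1) ℝ) ⁻¹' Ioo (-1 : ℝ) 1 := by
    ext w
    simp [MeasurableEquiv.funUnique, Fin.default_eq_zero]
  rw [← soloInformed_integral_two_mul_sqrt, hset, ← hmp.setIntegral_preimage_emb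
    (MeasurableEquiv.funUnique (Fin 1) ℝ).measurableEmbedding (fun t => 2 * Real.sqrt (1 - t ^ 2))
    (Ioo (-1 : ℝ) 1)]
  rfl

/-- `∫_{(−1,1)} dx/√(1 − x²) = π`. [Kontsevich–Zagier 2001, §1.1] -/
theorem soloInformed_value_piRepInvSqrt : soloInformedPiRepInvSqrt.value = Real.pi := by
  show ∫ w in {w : Fin 1 → ℝ | w 0 ∈ Ioo (-1 : ℝ) 1}, (Real.sqrt (1 - w 0 ^ 2))⁻¹ = Real.pi
  have hmp : MeasurePreserving (MeasurableEquiv.funUnique (Fin 1) ℝ) volume volume :=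
    volume_preserving_funUnique (Fin 1) ℝ
  have hset : {w : Fin 1 → ℝ | w 0 ∈ Ioo (-1 : ℝ) 1} =
      (MeasurableEquiv.funUnique (Fin 1) ℝ) ⁻¹' Ioo (-1 : ℝ) 1 := by
    ext w
    simp [MeasurableEquiv.funUnique, Fin.default_eq_zero]
  rw [← soloInformed_integral_inv_sqrt, hset, ← hmp.setIntegral_preimage_emb
    (MeasurableEquiv.funUnique (Fin 1) ℝ).measurableEmbedding (fun t => (Real.sqrt (1 - t ^ 2))⁻¹)
    (Ioo (-1 : ℝ) 1)]
  rfl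

/-- `[(−1, 1), 2√(1 − x²)]` is in the circle class (`2√(1 − x²) = 4τ/(1 + τ²)`). -/
theorem soloInformed_isKCircleOne_piRepSqrt : SoloInformedIsKCircleOne soloInformedPiRepSqrt := by
  refine ⟨Polynomial.C (4 : algebraicClosure ℚ ℝ) * Polynomial.X, 1 + Polynomial.X ^ 2,
    fun x hx => ?_, fun x hx => ?_⟩
  · obtain ⟨h1, h2⟩ := soloInformed_mem_piDom.1 hx
    refine ⟨h1, h2.le, ?_⟩
    rw [map_add, map_one, map_pow, Polynomial.aeval_X]
    positivity
  · obtain ⟨h1, h2⟩ := soloInformed_mem_piDom.1 hx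
    show 2 * Real.sqrt (1 - x 0 ^ 2) =
      (Polynomial.aeval (soloInformedCircInv (x 0)) (Polynomial.C (4 : algebraicClosure ℚ ℝ) * Polynomial.X) : ℝ) /
        Polynomial.aeval (soloInformedCircInv (x 0)) (1 + Polynomial.X ^ 2 : (algebraicClosure ℚ ℝ)[X])
    rw [soloInformed_sqrt_one_sub_sq h1 h2.le, map_mul, Polynomial.aeval_C, Polynomial.aeval_X, map_add,
      map_one, map_pow, Polynomial.aeval_X, map_ofNat]
    ring

/-- `[(−1, 1), 1/√(1 − x²)]` is in the circle class. -/
theorem soloInformed_isKCircleOne_piRepInvSqrt : SoloInformedIsKCircleOne soloInformedPiRepInvSqrt :=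
  soloInformed_isKCircleOne_inv_sqrt _ (fun _ hx => soloInformed_mem_piDom.1 hx) fun _ _ => rfl

/-! ## The theorems -/

/-- **[KZ01, §1.1] decided:** the representations `π = 2∫_{−1}^{1} √(1 − x²) dx` and
`π = ∫_{−1}^{1} dx/√(1 − x²)` are equivalent under the Kontsevich–Zagier rules.
[Kontsevich–Zagier 2001, §1.2 Question 1, for the example of §1.1; this work] -/
theorem soloInformed_kz_example_pi : Equivalent soloInformedPiRepSqrt soloInformedPiRepInvSqrt :=
  (soloInformed_kzp_isKCircleOne _ _ soloInformed_isKCircleOne_piRepSqrt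
    soloInformed_isKCircleOne_piRepInvSqrt).1
    (by rw [soloInformed_value_piRepSqrt, soloInformed_value_piRepInvSqrt])

/-- Both representations lie in the span of points and segments (so they are equivalent to every
other representation of `π` in that span, e.g. `[(0,1)², 4/(1+x²)]`-type ones once shown there). -/
theorem soloInformed_piRep_mem_segSpan :
    of soloInformedPiRepSqrt ∈ soloInformedSegSpan ∧ of soloInformedPiRepInvSqrt ∈ soloInformedSegSpan :=
  ⟨soloInformed_segSpan_of_isKCircleOne _ soloInformed_isKCircleOne_piRepSqrt,
    soloInformed_segSpan_of_isKCircleOne _ soloInformed_isKCircleOne_piRepInvSqrt⟩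

/-- A two-dimensional representation `[{−1 < x < 1, 0 ≤ y ≤ 2√(1 − x²)}, 1]` of `π` exists. -/
theorem soloInformed_exists_piRepArea :
    ∃ G : IntegralRep 2, G.domain = KZlog.band soloInformedPiRepSqrt.domain (fun _ => 0)
        soloInformedPiRepSqrt.integrand ∧ ∀ z ∈ G.domain, G.integrand z = 1 := by
  obtain ⟨G, hGdom, hG1, -⟩ := exists_underGraph soloInformedPiRepSqrt fun x _ => by
    show 0 ≤ 2 * Real.sqrt (1 - x 0 ^ 2)
    positivity
  exact ⟨G, hGdom, fun z _ => by rw [hG1]⟩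

/-- **[KZ01, §1.1] decided, area form:** every representation
`G = [{−1 < x < 1, 0 ≤ y ≤ 2√(1 − x²)}, 1]` has value `π` and is KZ-equivalent to both
one-dimensional representations. [Kontsevich–Zagier 2001, §1.1–1.2; this work] -/
theorem soloInformed_kz_example_pi_area (G : IntegralRep 2)
    (hGdom : G.domain = KZlog.band soloInformedPiRepSqrt.domain (fun _ => 0)
      soloInformedPiRepSqrt.integrand)
    (hG1 : ∀ z ∈ G.domain, G.integrand z = 1) :
    G.value = Real.pi ∧ Equivalent G soloInformedPiRepSqrt ∧ Equivalent G soloInformedPiRepInvSqrt := by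
  have h0 : ∀ x ∈ soloInformedPiRepSqrt.domain, 0 ≤ soloInformedPiRepSqrt.integrand x := fun x _ => by
    show 0 ≤ 2 * Real.sqrt (1 - x 0 ^ 2)
    positivity
  have hval : G.value = Real.pi := by
    rw [soloInformed_value_area soloInformedPiRepSqrt h0 G hGdom hG1, soloInformed_value_piRepSqrt]
  have hG : of G ∈ soloInformedSegSpan :=
    soloInformed_area_mem_segSpan soloInformedPiRepSqrt soloInformed_piRep_mem_segSpan.1 h0 G hGdom hG1
  exact ⟨hval,
    soloInformed_equivalent_of_mem_segSpan hG soloInformed_piRep_mem_segSpan.1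
      (by rw [hval, soloInformed_value_piRepSqrt]),
    soloInformed_equivalent_of_mem_segSpan hG soloInformed_piRep_mem_segSpan.2
      (by rw [hval, soloInformed_value_piRepInvSqrt])⟩

end Summit.KontsevichZagierPeriods.KontsevichZagierPeriods.Theorems
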